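import Literature.NumberTheory.EllipticCurves.LocalKummerMap
import Literature.NumberTheory.EllipticCurves.KummerMap
import HarnessLib

/-!
# The KUMMER INDEX: `[𝓛_v : loc_v(κ_n E(K))] = [E(K_v) : nE(K_v) + im E(K)]`
# (cell `b2b-bsdres`, sub-cell `multr1-p2`, gen 15 — shared by routes p2 and R1 of class X11b)

HONEST FRAMING (verbatim, cell `b2b-bsdres`): the goal of the cell is to DELETE the
COMBINATION-SHAPED residual classes for ALL analytic-rank `≤ 1` curves over `ℚ` — "full BSD
formula for every rank `≤ 1` curve in class `C`" assembled STRICTLY from published theorems — so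
that the rank-`≤ 1` remainder becomes exactly the CONSTRUCTION-SHAPED classes, which are TYPED
(missing-input Props), NOT attempted; this is not "finishing BSD". Research route `p2` for class
X11b; no claim beyond the stated class; nothing booked; X11b stays CONSTRUCTION-SHAPED. Theorems only; no `sorry`; no
named fact.

## Content (namespace `Summit.BirchSwinnertonDyer.Rank1Residual.X11b.KummerIndex`)

For an elliptic curve `E = W` over a field `K` of characteristic `0`, a `K`-field `E` (a completion
`K_v`), `n ≠ 0`, the global Kummer map `κ_n : E(K) → H¹(K, E[n])` (tree `kummerMapTorsion`) and the
local one `κ_{n,E} : (W⁄E)(E) → H¹(Γ_E, E[n])` (tree `localKummerMap`, image `𝓛_E =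
kummerLocalConditionAt`, kernel `n(W⁄E)(E)`):

* `baseChangeGeomPointsEquiv_toGeomPoints_baseChange` — the base change `E(K) → (W⁄E)(E)`
  (`Affine.Point.baseChange K E`) read in `E(K̄_E)` is `pointsMap` (same coordinates);
* **`res_kummerMapTorsion_eq_localKummerMap`: `res_E(κ_n P) = κ_{n,E}(P_E)`** (Silverman X.§4 (**),
  left square; tree `res_kummerClassTorsion` + `localKummerMap_eq_localKummerClass`);
* `map_res_range_kummerMapTorsion` (`loc_E(κ_n E(K)) = κ_{n,E}(im E(K))`), `…_le` (`≤ 𝓛_E`);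
* `relIndex_map_range_eq_index_sup_ker` (`[f(P) : f(U)] = [P : U + ker f]`, any hom `f`);
* **`relIndex_map_res_range_kummerMapTorsion`:
  `[𝓛_E : loc_E(κ_n E(K))] = [(W⁄E)(E) : n(W⁄E)(E) + im E(K)]`** — the local factor
  `#coker(E(K) ⊗ ℤ_p → E(K_v) ⊗ ℤ_p)` of Jetchev–Skinner–Wan 2017 Prop. 3.2.1 / Castella 2018 (3.2.1) at
  finite level, whose value at a multiplicative `p` under (iv) is `p^{min(k, ord_p log_ω Q + ord_p c_p − 1)}`
  (`BDPRouteLocalIndex`).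

Consumer: `BDPRouteRelaxation.lean` ([relaxed : Selmer] ≤ this index, by Poitou–Tate).

References: [SilvermanAEC2009] VIII.§2, X.§4 (diagram (**)); [JetchevSkinnerWan2017] Prop. 3.2.1
(arXiv:1512.06894 pp. 10–11); [Castella2018] (3.2.1) (arXiv:1704.06608 p. 6).
-/

noncomputable section

open scoped Classical

universe u

namespace Summit.BirchSwinnertonDyer.Rank1Residual.X11b.KummerIndex

open WeierstrassCurve Literature.NumberTheory.EllipticCurves Literature.NumberTheory.GaloisRepresentations
  Field Function

variable {K : Type u} [Field K] [CharZero K] (W : WeierstrassCurve K) [W.IsElliptic]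
variable (E : Type u) [Field E] [Algebra K E] [CharZero E] {n : ℤ} (hn : n ≠ 0)

omit [CharZero K] [W.IsElliptic] [CharZero E] in
/-- The base change `E(K) → (W⁄E)(E)` of rational points read in `E(K̄_E)`: through
`baseChangeGeomPointsEquiv`, the geometric point of `P_E` is `pointsMap` of the geometric point of `P`
(same coordinates). [folklore] -/
theorem baseChangeGeomPointsEquiv_toGeomPoints_baseChange (P : W.toAffine.Point) :
    W.baseChangeGeomPointsEquiv E (toGeomPoints (W.baseChange E)
        (Affine.Point.baseChange (W' := W) K E P)) =
      pointsMap W E (toGeomPoints W P) := by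
  have hjP : (Affine.Point.map (W' := W) (IsScalarTower.toAlgHom K E (AlgebraicClosure E))
      (Affine.Point.baseChange (W' := W) K E P) : localPoints W E) =
        pointsMap W E (toGeomPoints W P) := by
    change Affine.Point.map _ (Affine.Point.baseChange (W' := W) K E P) =
      Affine.Point.map (closureEmb (K := K) E)
        (Affine.Point.baseChange (W' := W) K (AlgebraicClosure K) P)
    rw [Affine.Point.map_baseChange, Affine.Point.map_baseChange]
  rw [← hjP]
  rcases P with _ | ⟨x, y, h⟩
  · rfl
  · rfl

omit [CharZero E] in
/-- **Localisation of the global Kummer map is the local Kummer map of the base-changed point**: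
`res_E (κ_n P) = κ_{n,E}(P_E)` for `P ∈ E(K)` (Silverman, *AEC*, X.§4, left square of (**)).
[cite: SilvermanAEC2009, X.§4 diagram (**)] -/
theorem res_kummerMapTorsion_eq_localKummerMap
    (hdiv : ∀ P : geomPoints W, ∃ Q : geomPoints W, n • Q = P) (P : W.toAffine.Point) :
    galoisCohomology.res (W.torsionGaloisModule n) E 1 (kummerMapTorsion W n hdiv P) =
      W.localKummerMap E hn (Affine.Point.baseChange (W' := W) K E P) := by
  obtain ⟨Q, hQ⟩ := hdiv (toGeomPoints W P)
  have hQfix : n • Q ∈ MulAction.fixedPoints (absoluteGaloisGroup K) (geomPoints W) := by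
    rw [hQ]; exact toGeomPoints_mem_fixedPoints W P
  rw [kummerMapTorsion_apply, kummerMapTorsionFun_eq W n hdiv P Q hQ,
    res_kummerClassTorsion W n (E := E) hn Q hQfix (zsmul_pointsMap_mem_fixedPoints W n (E := E) Q hQfix)]
  symm
  refine W.localKummerMap_eq_localKummerClass E hn _ _ _ ?_
  rw [← map_zsmul, hQ, baseChangeGeomPointsEquiv_toGeomPoints_baseChange]

omit [CharZero E] in
/-- **`loc_E(κ_n(E(K))) = κ_{n,E}(im(E(K) → (W⁄E)(E)))`**: the localised global Kummer image is the
local Kummer image of the base-changed rational points. [cite: SilvermanAEC2009, X.§4 diagram (**)] -/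
theorem map_res_range_kummerMapTorsion
    (hdiv : ∀ P : geomPoints W, ∃ Q : geomPoints W, n • Q = P) :
    ((kummerMapTorsion W n hdiv).range).map (galoisCohomology.res (W.torsionGaloisModule n) E 1) =
      ((Affine.Point.baseChange (W' := W) K E).range).map (W.localKummerMap E hn) := by
  apply le_antisymm
  · rintro _ ⟨_, ⟨P, rfl⟩, rfl⟩
    exact ⟨_, ⟨P, rfl⟩, (res_kummerMapTorsion_eq_localKummerMap W E hn hdiv P).symm⟩
  · rintro _ ⟨_, ⟨P, rfl⟩, rfl⟩
    exact ⟨_, ⟨P, rfl⟩, res_kummerMapTorsion_eq_localKummerMap W E hn hdiv P⟩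

omit [CharZero K] [W.IsElliptic] [CharZero E] in
/-- For `f : P → A` and `U ≤ P`: `[f(P) : f(U)] = [P : U + ker f]`. [folklore] -/
theorem relIndex_map_range_eq_index_sup_ker {P A : Type*} [AddCommGroup P] [AddCommGroup A]
    (f : P →+ A) (U : AddSubgroup P) : (U.map f).relIndex f.range = (U ⊔ f.ker).index := by
  have h1 : (U.map f).addSubgroupOf f.range = U.map f.rangeRestrict := by
    ext ⟨y, hy⟩
    simp only [AddSubgroup.mem_addSubgroupOf, AddSubgroup.mem_map]
    constructor
    · rintro ⟨u, hu, huy⟩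
      exact ⟨u, hu, Subtype.ext huy⟩
    · rintro ⟨u, hu, huy⟩
      exact ⟨u, hu, congrArg Subtype.val huy⟩
  rw [AddSubgroup.relIndex, h1, AddSubgroup.index_map, AddMonoidHom.ker_rangeRestrict,
    AddMonoidHom.range_eq_top.mpr (AddMonoidHom.rangeRestrict_surjective f), AddSubgroup.index_top,
    mul_one]

include hn in
/-- **The Kummer index**: `[𝓛_E : loc_E(κ_n(E(K)))] = [(W⁄E)(E) : n(W⁄E)(E) + im E(K)]` — the local
Kummer condition `𝓛_E = κ_{n,E}((W⁄E)(E))` (`range_localKummerMap`) modulo the localised global Kummer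
classes is `(W⁄E)(E)` modulo `n(W⁄E)(E) = ker κ_{n,E}` (`ker_localKummerMap`) and the image of `E(K)`.
This is the local factor "#coker(E(K) ⊗ ℤ_p → E(K_v) ⊗ ℤ_p) mod p^k" of Jetchev–Skinner–Wan 2017
Prop. 3.2.1 / Castella 2018 (3.2.1), at finite level. [cite: JetchevSkinnerWan2017, Prop. 3.2.1 (proof)]
[cite: SilvermanAEC2009, X.§4 diagram (**)] -/
theorem relIndex_map_res_range_kummerMapTorsion
    (hdiv : ∀ P : geomPoints W, ∃ Q : geomPoints W, n • Q = P) :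
    (((kummerMapTorsion W n hdiv).range).map
        (galoisCohomology.res (W.torsionGaloisModule n) E 1)).relIndex (W.kummerLocalConditionAt n E) =
      ((Affine.Point.baseChange (W' := W) K E).range ⊔
        (zsmulAddGroupHom n : (W.baseChange E).toAffine.Point →+ _).range).index := by
  rw [map_res_range_kummerMapTorsion W E hn hdiv, ← W.range_localKummerMap E hn,
    relIndex_map_range_eq_index_sup_ker, W.ker_localKummerMap E hn]

include hn in
/-- The localised global Kummer classes lie in the local Kummer condition:
`loc_E(κ_n(E(K))) ≤ 𝓛_E`. [cite: SilvermanAEC2009, X.§4 diagram (**)] -/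
theorem map_res_range_kummerMapTorsion_le
    (hdiv : ∀ P : geomPoints W, ∃ Q : geomPoints W, n • Q = P) :
    ((kummerMapTorsion W n hdiv).range).map (galoisCohomology.res (W.torsionGaloisModule n) E 1) ≤
      W.kummerLocalConditionAt n E := by
  rw [map_res_range_kummerMapTorsion W E hn hdiv, ← W.range_localKummerMap E hn]
  exact AddSubgroup.map_le_range _ _

end Summit.BirchSwinnertonDyer.Rank1Residual.X11b.KummerIndex


end
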